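import Literature.Computability.QuantumComplexity.HidingPostMachine
import Literature.Computability.QuantumComplexity.HidingStruct
import Literature.Computability.Complexity.OracleClosure
import HarnessLib

/-!
# The `FBPP^{NP^𝒪}` solver of the proof of AA13 Thm. 1.3: oracle-machine membership and semantics

Family `quantum-advantage`, sequel of `HidingProgram.lean` / `HidingProgramMachine.lean` /
`HidingPostMachine.lean`. Given the Stockmeyer counter `F ∈ FP^{L}` (Thm. 4.1), the machine of the
discharge of Aaronson–Arkhipov's Thm. 1.3 is the composite

  `gpeSolver w = post ⟨w, F (pre w)⟩`

of the polynomial-time string functions `pre`, `post` extracted from `preFun_codeFP`,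
`postFun_codeFP`. This file proves:

* `gpeSolver_mem_FPRel` — **the solver is in `FP^{L}`** (`postPre_mem_FPRel`);
* `gpeRandOracleEstimate_gpeSolver` — on the GPE query `⟨n, b, kε, kδ, X̃⟩` with coins `r` its
  decoded answer is `postFun ((⟨n, b, kε, kδ, rows X̃⟩, r), F (preFun (…, r)))` (`encodeGPEQuery_eq`);
* **`postFun_eq_zStruct`** — the STRUCTURED form (`zStruct`, `HidingStruct.lean`) of that answer on well-formed
  inputs: with the coins split as `r = r_S r_B u` into positions `S` (`finTuple`), the sampler array
  `B_c` (`arrOfCoins`) and the counter's coins `u`, and `B' = overwrite B_c S X̃` with independent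
  columns, the answer is `zOf b n Ñ ℓ (∏ d_{2c+1}) (∏ d_{2c})` where `Ñ` is the counter's estimate
  on the instance `⟨⟨⟨n, e, b_q, E⟩, 1^{kβ}⟩, S⟩`, `E = hiddenOf b_q B'`, `ℓ = c_𝒪(|x'|)` — the
  quantities the probabilistic analysis is about.

All proved, no new named facts.

## References

* S. Aaronson, A. Arkhipov, *The computational complexity of linear optics*, Theory of Computing 9
  (2013) 143–252, proof of Thm. 1.3, §5.2 (pp. 192–195), Thm. 4.1 (p. 175), Def. 3.11 (p. 174).
* S. Arora, B. Barak, *Computational Complexity: A Modern Approach*, CUP 2009, §3.4 (oracle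
  machines), §1.3.
-/

noncomputable section

namespace Literature.Computability.QuantumComplexity

open Polynomial Literature.Computability.Complexity Literature.Computability.Complexity.CodeFP
  Literature.Computability.Cryptography Literature.Probability.Distributions
  Literature.Combinatorics.Enumerative Literature.Analysis.Matrix Literature.Algebra.EuclideanLattices

section Solver

variable (H : HPolys) (p₀ cO cS : Polynomial ℕ) (F : List Bool → List Bool)

/-! ### The string functions and the solver -/

/-- The pre-processing as a string function (the `FP` witness of `preFun_codeFP`). [folklore] -/
def preF : List Bool → List Bool := Classical.choose (preFun_codeFP H p₀ cO cS)

/-- `preF ∈ FP`. [folklore] -/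
theorem preF_mem_FP : preF H p₀ cO cS ∈ FP := (Classical.choose_spec (preFun_codeFP H p₀ cO cS)).1

/-- `preF` computes `preFun` on codes. [folklore] -/
theorem preF_apply (q : GIn × List Bool) : preF H p₀ cO cS (inE q) = preFun H p₀ cO cS q :=
  (Classical.choose_spec (preFun_codeFP H p₀ cO cS)).2 q

/-- The post-processing as a string function (the `FP` witness of `postFun_codeFP`). [folklore] -/
def postF : List Bool → List Bool := Classical.choose (postFun_codeFP H p₀ cO)

/-- `postF ∈ FP`. [folklore] -/
theorem postF_mem_FP : postF H p₀ cO ∈ FP := (Classical.choose_spec (postFun_codeFP H p₀ cO)).1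

/-- `postF` computes `postFun` on codes. [folklore] -/
theorem postF_apply (q : (GIn × List Bool) × List Bool) : postF H p₀ cO (pairE inE strE q) = smE (postFun H p₀ cO q) :=
  (Classical.choose_spec (postFun_codeFP H p₀ cO)).2 q

/-- **The solver**: `w ↦ post ⟨w, F (pre w)⟩` around the counter `F`. [cite: AaronsonArkhipovToC2013, proof of Thm. 1.3 (pp. 193–195)] -/
def gpeSolver : List Bool → List Bool := fun w => postF H p₀ cO (boolPair w (F (preF H p₀ cO cS w)))

/-- **The solver is a polynomial-time oracle transducer relative to the counter's oracle.**
[cite: AaronsonArkhipovToC2013, proof of Thm. 1.3 (p. 193) with Thm. 4.1 (p. 175)] -/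
theorem gpeSolver_mem_FPRel {O' : Oracle} (hF : F ∈ FPRel O') : gpeSolver H p₀ cO cS F ∈ FPRel O' :=
  postPre_mem_FPRel hF (preF_mem_FP H p₀ cO cS) (postF_mem_FP H p₀ cO)

/-- The solver on a coded input. [folklore] -/
theorem gpeSolver_inE (q : GIn × List Bool) :
    gpeSolver H p₀ cO cS F (inE q) = smE (postFun H p₀ cO (q, F (preFun H p₀ cO cS q))) := by
  rw [gpeSolver, preF_apply, ← postF_apply]
  rfl

variable {n : ℕ}

/-- The GPE query code, spelled out (this is `ginE (n, b, kε, kδ, rows X̃)`). [folklore] -/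
theorem encodeGPEQuery_eq (b kε kδ : ℕ) (X : Fin n → Fin n → ℤ × ℤ) :
    encodeGPEQuery ⟨n, b, kε, kδ, X⟩ =
      boolPair (natE n) (boolPair (natE b) (boolPair (natE kε) (boolPair (natE kδ) (listE (listE (pairE smE smE)) (rowsOf X))))) := by
  simp only [encodeGPEQuery, encodingGPEQuery, encodingIntPairMatrix, Computability.Encoding.sigmaBool,
    Computability.Encoding.pairBool, encodingFinVec, listE_eq]
  rw [rowsOf, show (List.ofFn fun r => List.ofFn (X r)) = (List.ofFn X).map (fun v => List.ofFn v) by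
    rw [List.map_ofFn]; rfl, listE_map]
  rfl

/-- **The solver's decoded answer on a GPE query with coins** is `postFun` of the query tuple, the
coins and the counter's reply to `preFun`. [cite: AaronsonArkhipovToC2013, proof of Thm. 1.3 (pp. 193–195)] -/
theorem gpeRandOracleEstimate_gpeSolver (b kε kδ : ℕ) (X : _root_.Matrix (Fin n) (Fin n) (ℤ × ℤ)) (r : List Bool) :
    GPERandOracleEstimate (gpeSolver H p₀ cO cS F) n b kε kδ X r =
      postFun H p₀ cO (((n, b, kε, kδ, rowsOf X), r), F (preFun H p₀ cO cS ((n, b, kε, kδ, rowsOf X), r))) := by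
  rw [GPERandOracleEstimate, encodeGPEQuery_eq, show boolPair (boolPair (natE n) (boolPair (natE b) (boolPair (natE kε)
      (boolPair (natE kδ) (listE (listE (pairE smE smE)) (rowsOf X)))))) r = inE ((n, b, kε, kδ, rowsOf X), r) from rfl,
    gpeSolver_inE, smE]
  rw [encodingIntBool.decode_encode]
  rfl

end Solver

/-! ### The structured form of the answer -/

section Struct

variable {n e : ℕ}

variable (H : HPolys) (p₀ cO cS : Polynomial ℕ) (F : List Bool → List Bool)

/-- **The machine's answer is the structured answer** on a well-formed query `⟨n, b, kε, kδ, X̃⟩`,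
`n ≥ 1`, with coins `r = r_S r_B u` of the right field lengths (`N = n + kε + kδ ≤ |r|`, `b ≤ |r|`,
`m(N) = n + e`), positions `S_i =` block `i` of `r_S`, sampler array `B_c` from `r_B`, whenever the
planted array has `ℂ`-independent columns. [cite: AaronsonArkhipovToC2013, proof of Thm. 1.3 (pp. 192–195)] -/
theorem postFun_eq_zStruct {b kε kδ N : ℕ} (hN : n + kε + kδ = N) (hn : 0 < n) (he : H.m N = n + e)
    (x : Fin n → Fin n → ℤ × ℤ) (vS : List.Vector Bool (n * H.μ N))
    (vB : List.Vector Bool ((n + e) * (n * (2 * (H.pg b N).coinLen)))) (u : List Bool)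
    (S : Fin n → Fin (n + e)) (hS : S = fun i => Fin.cast he (finTuple vS i))
    (Bc : Fin (n + e) → Fin n → ℤ × ℤ) (hBc : Bc = arrOfCoins (H.pg b N) vB)
    (hNr : N ≤ (vS.toList ++ vB.toList ++ u).length) (hbr : b ≤ (vS.toList ++ vB.toList ++ u).length)
    (hli : LinearIndependent ℂ (colVec (gaussIntMatrix (overwrite Bc S x)))) :
    postFun H p₀ cO (((n, b, kε, kδ, rowsOf x), (vS.toList ++ vB.toList ++ u)), F (preFun H p₀ cO cS ((n, b, kε, kδ, rowsOf x), (vS.toList ++ vB.toList ++ u)))) =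
      zStruct cO cS F b (H.bq p₀ N) (H.kβ N) (H.kη N) (H.kδS N) x S Bc u := by
  have hNr' : n + kε + kδ ≤ (vS.toList ++ vB.toList ++ u).length := by omega
  -- the clipped scalars
  have hnC : GIn.nC (n, b, kε, kδ, rowsOf x) (vS.toList ++ vB.toList ++ u) = n := GIn.nC_eq hNr'
  have hbC : GIn.bC (n, b, kε, kδ, rowsOf x) (vS.toList ++ vB.toList ++ u) = b := GIn.bC_eq hbr
  have hNC : GIn.NC (n, b, kε, kδ, rowsOf x) (vS.toList ++ vB.toList ++ u) = N := (GIn.NC_eq hNr').trans hN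
  have hpg : pgOf H (n, b, kε, kδ, rowsOf x) (vS.toList ++ vB.toList ++ u) = H.pg b N := by rw [pgOf, hbC, hNC]
  -- the coin fields
  have hlS : vS.toList.length = n * H.μ N := vS.toList_length
  have hlB : vB.toList.length = (n + e) * (n * (2 * (H.pg b N).coinLen)) := vB.toList_length
  have hcS : coinsS H (n, b, kε, kδ, rowsOf x) (vS.toList ++ vB.toList ++ u) = vS.toList := by
    rw [coinsS, hnC, hNC, List.append_assoc]
    exact List.take_left' hlS
  have hcB : coinsB H (n, b, kε, kδ, rowsOf x) (vS.toList ++ vB.toList ++ u) = vB.toList := by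
    rw [coinsB, hnC, hNC, hpg, he, List.append_assoc, List.drop_left' hlS]
    exact List.take_left' hlB
  have hcU : coinsU H (n, b, kε, kδ, rowsOf x) (vS.toList ++ vB.toList ++ u) = u := by
    rw [coinsU, hnC, hNC, hpg, he, ← List.drop_drop, List.append_assoc, List.drop_left' hlS]
    exact List.drop_left' hlB
  -- positions, array, planting, hiding
  have hpos : posTop H (n, b, kε, kδ, rowsOf x) (vS.toList ++ vB.toList ++ u) = List.ofFn fun i => ((S i : Fin (n + e)) : ℕ) := by
    rw [posTop, hnC, hNC, hcS, posL_toList, hS]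
    rfl
  have hrows : coinRowsL (pgOf H (n, b, kε, kδ, rowsOf x) (vS.toList ++ vB.toList ++ u)).ctx (pgOf H (n, b, kε, kδ, rowsOf x) (vS.toList ++ vB.toList ++ u)).coinLen (H.m (GIn.NC (n, b, kε, kδ, rowsOf x) (vS.toList ++ vB.toList ++ u))) (GIn.nC (n, b, kε, kδ, rowsOf x) (vS.toList ++ vB.toList ++ u)) (coinsB H (n, b, kε, kδ, rowsOf x) (vS.toList ++ vB.toList ++ u)) =
      rowsOf Bc := by
    rw [hpg, hNC, hnC, hcB, he, coinRowsL_toList, hBc]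
  have hplant : plantedTop H (n, b, kε, kδ, rowsOf x) (vS.toList ++ vB.toList ++ u) = rowsOf (overwrite Bc S x) := by
    rw [plantedTop, hrows, hpos]
    exact rowsOf_overwrite Bc S x
  have hhid : hiddenTop H p₀ (n, b, kε, kδ, rowsOf x) (vS.toList ++ vB.toList ++ u) = rowsOf (hiddenOf (H.bq p₀ N) (overwrite Bc S x)) := by
    rw [hiddenTop, hplant, hNC, hnC]
    exact hiddenL_rowsOf _ _ hli
  have hquery : queryTop H p₀ (n, b, kε, kδ, rowsOf x) (vS.toList ++ vB.toList ++ u) = queryS (H.bq p₀ N) (H.kβ N) (hiddenOf (H.bq p₀ N) (overwrite Bc S x)) := by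
    rw [queryTop, hhid, hnC, hNC, he, Nat.add_sub_cancel_left, queryS, encode_bosonInput_eq]
    rfl
  have hinst : instTop H p₀ (n, b, kε, kδ, rowsOf x) (vS.toList ++ vB.toList ++ u) = instS (H.bq p₀ N) (H.kβ N) (hiddenOf (H.bq p₀ N) (overwrite Bc S x)) S := by
    rw [instTop, hquery, hpos, instS, instL, encodeBosonOutcome_eq_listE]
  -- the answer
  have hn0 : GIn.nC (n, b, kε, kδ, rowsOf x) (vS.toList ++ vB.toList ++ u) ≠ 0 := by rw [hnC]; omega
  rw [postFun, if_neg hn0, zStruct, zArr]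
  simp only
  rw [hbC, hnC, hplant, dProdOdd_rowsOf, dProdEven_rowsOf, ellTop, hquery, preFun, ← countEstimate_def]
  simp only
  rw [hinst, ellTop, hquery, hNC, hcU, sclTop, hinst, ellTop, hquery, hNC]

end Struct

end Literature.Computability.QuantumComplexity
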